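import Mathlib
import HarnessLib
import Literature.Analysis.FluidPDE.VorticityCalculus

/-!
# Item `PoloidalWindowRigidity` (stmt-NavierStokesRegularity-19708), LINE 21 «hot_hull» (ns-idea-8) — H4 `stub_nullEndTopology` BY SIGNATURE

Cell ns-regularity-ideate, seat ns-k2-port-2 g4 (`--supports stmt-NavierStokesRegularity-19708 --as helper`; CLAIM nsreg STATUS 2026-08-29T06:41:30Z).  The statement
is `NullEndTopology` of `Cruxes/PoloidalWindowRigidity/Lines/hot_hull.lean` (:1128–1140) VERBATIM with the line-file abbreviation
`hotSet w = {y | y₂ = 0 ∧ w₂(−1,y) = w₂(−1,0)}` δ-unfolded, so that `stub_nullEndTopology : NullEndTopology := nullEndTopology` closes the stub by `exact`.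

CLAIM (pure topology + the two locally uniform convergences).  An escaping hot curve `γ` with `ω(−1,γ τ) → 0` along the end `l`, whose translates by
`γ(τs k)` (`τs k → l`) converge locally uniformly (slice and vorticity slice) to `U(−1,·)`, `ω_U(−1,·)`, leaves in `U` a CONNECTED UNBOUNDED set `L ∋ 0` of hot
points of `U` on which `ω_U(−1,·) = 0`.

PROOF (forward arcs — no Hausdorff-metric limits, no boundary bumping, injectivity of `γ` unused).  Case `l = atTop` (`atBot` by the reflection `τ ↦ −τ`).
For `R > 0` and each `k` let `σ_k := inf {σ ≥ τs k : ‖γ σ − γ(τs k)‖ ≥ R}` (exists: `γ → ∞`; attained: `IsClosed.csInf_mem`) and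
`B_k := {γ σ − γ(τs k) : σ ∈ [τs k, σ_k]}` — connected, `∋ 0`, inside `closedBall 0 R`, containing the exit point of norm `R`, made of translated HOT points whose
parameters are `≥ τs k → +∞`, so `sup_{B_k} ‖ω(−1, · + γ(τs k))‖ → 0`.  The topological upper limit `Λ_R := ⋂ₙ closure (⋃_{k ≥ n} B_k)` is a nested intersection of
continua each containing `0`, hence connected (`isPreconnected_iInter_nested`: compactness + normal separation + the finite-intersection property); it contains `0`
and a limit of exit points (norm `R`); and every `x ∈ Λ_R` is approximated by points `y ∈ B_k`, `k` large, near which `v(−1, · + γ(τs k))` is uniformly close to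
`U(−1,·)` and `ω(−1, · + γ(τs k))` to `ω_U(−1,·)` — so `U₂(−1,x) = N`, `x₂ = 0`, `ω_U(−1,x) = 0`.  Finally `L := ⋃_{m ∈ ℕ} Λ_{m+1}` is connected (common point `0`)
and unbounded.

WHAT THIS IS NOT: not a claim about Navier–Stokes regularity; one M-sized stub of LINE 21 (W4 ⟨19708⟩ / N0 ⟨20428⟩ by name); the research cells of the line are
untouched; 19708/20428/27893 OPEN.
-/

noncomputable section

-- the summit and its single sub-problem share the name (CONVENTIONS §1), as in every Theorems file
set_option linter.dupNamespace false

namespace Summit.NavierStokesRegularity.NavierStokesRegularity.Theorems.PoloidalWindowDoorPoloidalWindowRigidityHotHullNullEndTopology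

open Set Function Filter Topology Metric Bornology
open Literature.Analysis Literature.Analysis.FluidPDE

/-! ### Nested continua -/

/-- **A nested intersection of continua is connected**: `K n` compact, preconnected, antitone in `n` (in a metric space) ⇒ `⋂ n, K n` is preconnected. -/
theorem isPreconnected_iInter_nested {X : Type*} [MetricSpace X] {K : ℕ → Set X} (hK : ∀ n, IsCompact (K n)) (hconn : ∀ n, IsPreconnected (K n))
    (hmono : ∀ n, K (n + 1) ⊆ K n) : IsPreconnected (⋂ n, K n) := by
  have hanti : Antitone K := antitone_nat_of_succ_le hmono
  have hcl : ∀ n, IsClosed (K n) := fun n => (hK n).isClosed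
  have hS : IsClosed (⋂ n, K n) := isClosed_iInter hcl
  rw [isPreconnected_iff_subset_of_fully_disjoint_closed hS]
  intro a b ha hb hab hdisj
  obtain ⟨u, v, hu, hv, hau, hbv, huv⟩ := normal_separation ha hb hdisj
  -- some `K n` already lies in `u ∪ v`
  have hempty : (K 0 ∩ ⋂ n, (K n ∩ (u ∪ v)ᶜ)) = ∅ := by
    apply Set.eq_empty_of_forall_notMem
    rintro x ⟨-, hx⟩
    rw [mem_iInter] at hx
    have hxS : x ∈ ⋂ n, K n := mem_iInter.2 fun n => (hx n).1
    have hx2 := (hx 0).2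
    exact hx2 ((union_subset_union hau hbv) (hab hxS))
  have hanti' : Antitone fun n => K n ∩ (u ∪ v)ᶜ := fun m n hmn => inter_subset_inter_left _ (hanti hmn)
  have hdir : Directed (· ⊇ ·) fun n => K n ∩ (u ∪ v)ᶜ := hanti'.directed_ge
  obtain ⟨n, hn⟩ := (hK 0).elim_directed_family_closed (fun n => K n ∩ (u ∪ v)ᶜ)
    (fun n => (hcl n).inter (hu.union hv).isClosed_compl) hempty hdir
  have hKn : K n ⊆ u ∪ v := by
    intro x hx
    by_contra hxuv
    have : x ∈ K 0 ∩ (K n ∩ (u ∪ v)ᶜ) := ⟨hanti (Nat.zero_le n) hx, hx, hxuv⟩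
    rw [hn] at this
    exact this
  have hSn : (⋂ n, K n) ⊆ K n := iInter_subset _ n
  rcases (hconn n).subset_or_subset hu hv huv hKn with h | h
  · left
    intro x hx
    rcases hab hx with hxa | hxb
    · exact hxa
    · exact absurd (Set.disjoint_left.mp huv (h (hSn hx))) (not_not.mpr (hbv hxb))
  · right
    intro x hx
    rcases hab hx with hxa | hxb
    · exact absurd (Set.disjoint_left.mp huv (hau hxa)) (not_not.mpr (h (hSn hx)))
    · exact hxb

/-! ### The topological upper limit of a sequence of sets -/

/-- The topological upper limit `⋂ₙ closure (⋃ₖ A (n+k))` of sets inside a closed set stays inside it. -/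
theorem limsup_subset_of_subset {X : Type*} [TopologicalSpace X] {A : ℕ → Set X} {C : Set X} (hC : IsClosed C) (hA : ∀ k, A k ⊆ C) :
    (⋂ n : ℕ, closure (⋃ k : ℕ, A (n + k))) ⊆ C := fun _ hx =>
  (hC.closure_subset_iff.2 (iUnion_subset fun k => hA (0 + k))) ((mem_iInter.1 hx) 0)

/-- A point lying in every `A k` lies in the upper limit. -/
theorem mem_limsup_of_forall_mem {X : Type*} [TopologicalSpace X] {A : ℕ → Set X} {x : X} (hx : ∀ k, x ∈ A k) :
    x ∈ ⋂ n : ℕ, closure (⋃ k : ℕ, A (n + k)) :=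
  mem_iInter.2 fun n => subset_closure (mem_iUnion.2 ⟨0, hx (n + 0)⟩)

/-- The limit of a sequence `s k ∈ A k` lies in the upper limit. -/
theorem mem_limsup_of_tendsto {X : Type*} [TopologicalSpace X] {A : ℕ → Set X} {s : ℕ → X} (hs : ∀ k, s k ∈ A k) {φ : ℕ → ℕ} (hφ : StrictMono φ)
    {x : X} (hx : Tendsto (s ∘ φ) atTop (𝓝 x)) : x ∈ ⋂ n : ℕ, closure (⋃ k : ℕ, A (n + k)) := by
  refine mem_iInter.2 fun n => mem_closure_of_tendsto hx (Filter.eventually_atTop.2 ⟨n, fun j hj => mem_iUnion.2 ⟨φ j - n, ?_⟩⟩)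
  have h : n ≤ φ j := hj.trans (hφ.id_le j)
  rw [Nat.add_sub_cancel' h]
  exact hs (φ j)

/-- **Approximation from the upper limit**: if `x ∈ ⋂ₙ closure (⋃ₖ A (n+k))` then for every neighbourhood `t` of `x` and every `n` there are `k ≥ n` and
`y ∈ t ∩ A k`. -/
theorem exists_mem_of_mem_limsup {X : Type*} [TopologicalSpace X] {A : ℕ → Set X} {x : X} (hx : x ∈ ⋂ n : ℕ, closure (⋃ k : ℕ, A (n + k)))
    {t : Set X} (ht : t ∈ 𝓝 x) (n : ℕ) : ∃ k, n ≤ k ∧ ∃ y ∈ t, y ∈ A k := by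
  have h := (mem_iInter.1 hx) n
  rw [mem_closure_iff_nhds] at h
  obtain ⟨y, hyt, hy⟩ := h t ht
  obtain ⟨k, hk⟩ := mem_iUnion.1 hy
  exact ⟨n + k, Nat.le_add_right _ _, y, hyt, hk⟩

/-- **The upper limit of connected sets with a common point in a fixed closed ball is connected** (proper metric space). -/
theorem isPreconnected_limsup {X : Type*} [MetricSpace X] [ProperSpace X] {A : ℕ → Set X} {x₀ : X} {R : ℝ} (hA : ∀ k, A k ⊆ closedBall x₀ R)
    (hconn : ∀ k, IsPreconnected (A k)) {p : X} (hp : ∀ k, p ∈ A k) : IsPreconnected (⋂ n : ℕ, closure (⋃ k : ℕ, A (n + k))) := by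
  refine isPreconnected_iInter_nested (fun n => ?_) (fun n => ?_) (fun n => ?_)
  · exact (isCompact_closedBall x₀ R).of_isClosed_subset isClosed_closure
      (isClosed_closedBall.closure_subset_iff.2 (iUnion_subset fun k => hA (n + k)))
  · exact (isPreconnected_iUnion ⟨p, mem_iInter.2 fun k => hp (n + k)⟩ fun k => hconn (n + k)).closure
  · refine closure_mono (iUnion_subset fun k => ?_)
    have e : n + 1 + k = n + (k + 1) := by ring
    rw [e]
    exact subset_iUnion (fun k => A (n + k)) (k + 1)

/-! ### Forward exit arcs of an escaping curve -/

/-- **The forward exit arc.**  For a continuous curve `γ` escaping to infinity at `+∞`, a base parameter `τ₀` and a radius `R > 0`: the arc of `γ − γ τ₀` from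
`τ₀` to the first forward exit of `closedBall 0 R` is a connected set `B ∋ 0` inside the ball, containing a point of norm `R`, all of whose points are
`γ σ − γ τ₀` with `σ ≥ τ₀`. -/
theorem exists_exitArc {γ : ℝ → EuclideanSpace ℝ (Fin 3)} (hγ : Continuous γ) (hesc : Tendsto γ atTop (cocompact _)) (τ₀ : ℝ) {R : ℝ} (hR : 0 < R) :
    ∃ B : Set (EuclideanSpace ℝ (Fin 3)), IsPreconnected B ∧ (0 : EuclideanSpace ℝ (Fin 3)) ∈ B ∧ B ⊆ closedBall 0 R ∧ (∃ s ∈ B, ‖s‖ = R) ∧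
      ∀ x ∈ B, ∃ σ, τ₀ ≤ σ ∧ x = γ σ - γ τ₀ := by
  set S : Set ℝ := {σ | τ₀ ≤ σ ∧ R ≤ ‖γ σ - γ τ₀‖} with hSdef
  have hnc : Continuous fun σ => ‖γ σ - γ τ₀‖ := (hγ.sub continuous_const).norm
  have hSc : IsClosed S := (isClosed_le continuous_const continuous_id).inter (isClosed_le continuous_const hnc)
  -- `S` is non-empty: `γ` leaves the compact ball `closedBall (γ τ₀) R`
  have hSne : S.Nonempty := by
    have hev := hesc.eventually (mem_map.1 ((isCompact_closedBall (γ τ₀) R).compl_mem_cocompact))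
    obtain ⟨T, hT⟩ := Filter.eventually_atTop.1 (hev.and (Filter.eventually_ge_atTop τ₀))
    obtain ⟨h1, h2⟩ := hT T le_rfl
    refine ⟨T, h2, ?_⟩
    rw [mem_compl_iff, mem_closedBall, dist_eq_norm, not_le] at h1
    exact h1.le
  have hSbdd : BddBelow S := ⟨τ₀, fun σ hσ => hσ.1⟩
  have hmem : sInf S ∈ S := hSc.csInf_mem hSne hSbdd
  have hτ₀le : τ₀ ≤ sInf S := hmem.1
  have hlt : ∀ σ, τ₀ ≤ σ → σ < sInf S → ‖γ σ - γ τ₀‖ < R := by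
    intro σ h1 h2
    by_contra h
    exact absurd (csInf_le hSbdd ⟨h1, not_lt.1 h⟩) (not_le.2 h2)
  -- at the exit parameter the norm is exactly `R`
  have hexit : ‖γ (sInf S) - γ τ₀‖ = R := by
    refine le_antisymm ?_ hmem.2
    by_contra hgt
    rw [not_le] at hgt
    rcases eq_or_lt_of_le hτ₀le with h0 | h0
    · rw [← h0, sub_self, norm_zero] at hgt
      exact absurd hgt (not_lt.2 hR.le)
    · -- continuity from the left contradicts `‖·‖ < R` before the exit
      have hopen : IsOpen {σ | R < ‖γ σ - γ τ₀‖} := isOpen_lt continuous_const hnc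
      obtain ⟨δ, hδ, hball⟩ := Metric.isOpen_iff.1 hopen (sInf S) hgt
      set σ := max τ₀ (sInf S - δ / 2) with hσ
      have hσ1 : τ₀ ≤ σ := le_max_left _ _
      have hσ2 : σ < sInf S := max_lt h0 (by linarith)
      have hσ3 : σ ∈ ball (sInf S) δ := by
        rw [mem_ball, Real.dist_eq, abs_lt]
        have hge : sInf S - δ / 2 ≤ σ := le_max_right _ _
        constructor <;> linarith
      have h4 : R < ‖γ σ - γ τ₀‖ := hball hσ3
      linarith [hlt σ hσ1 hσ2]
  refine ⟨(fun σ => γ σ - γ τ₀) '' Icc τ₀ (sInf S), ?_, ?_, ?_, ?_, ?_⟩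
  · exact (isPreconnected_Icc).image _ ((hγ.sub continuous_const).continuousOn)
  · exact ⟨τ₀, ⟨le_rfl, hτ₀le⟩, by simp⟩
  · rintro x ⟨σ, ⟨h1, h2⟩, rfl⟩
    rw [mem_closedBall, dist_zero_right]
    rcases eq_or_lt_of_le h2 with h | h
    · rw [h, hexit]
    · exact (hlt σ h1 h).le
  · exact ⟨γ (sInf S) - γ τ₀, ⟨sInf S, ⟨hτ₀le, le_rfl⟩, rfl⟩, hexit⟩
  · rintro x ⟨σ, ⟨h1, -⟩, rfl⟩
    exact ⟨σ, h1, rfl⟩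

/-! ### The null-end theorem, end `+∞` -/

/-- A coordinate is `1`-Lipschitz: `|a₂ − b₂| ≤ ‖a − b‖`. -/
theorem abs_sub_apply_le (a b : EuclideanSpace ℝ (Fin 3)) (i : Fin 3) : |a i - b i| ≤ dist a b := by
  rw [dist_eq_norm, ← Real.norm_eq_abs]
  exact PiLp.norm_apply_le (a - b) i

/-- **H4 at the end `+∞`** (all of the topology; see the module docstring). -/
theorem nullEnd_atTop {v U : ℝ → EuclideanSpace ℝ (Fin 3) → EuclideanSpace ℝ (Fin 3)} {γ : ℝ → EuclideanSpace ℝ (Fin 3)} {τs : ℕ → ℝ}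
    (hγ : Continuous γ) (hhot : ∀ τ : ℝ, γ τ 2 = 0 ∧ v (-1) (γ τ) 2 = v (-1) 0 2) (hesc : Tendsto γ atTop (cocompact _))
    (hω : Tendsto (fun τ => curl (v (-1)) (γ τ)) atTop (𝓝 0)) (hτs : Tendsto τs atTop atTop) (hUc : Continuous (U (-1)))
    (hωc : Continuous (curl (U (-1)))) (hlu₁ : TendstoLocallyUniformly (fun k x => v (-1) (x + γ (τs k))) (U (-1)) atTop)
    (hlu₂ : TendstoLocallyUniformly (fun k x => curl (v (-1)) (x + γ (τs k))) (curl (U (-1))) atTop) :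
    ∃ L : Set (EuclideanSpace ℝ (Fin 3)), L ⊆ {y | y 2 = 0 ∧ U (-1) y 2 = U (-1) 0 2} ∧ (0 : EuclideanSpace ℝ (Fin 3)) ∈ L ∧ IsConnected L ∧
      ¬ IsBounded L ∧ ∀ x ∈ L, curl (U (-1)) x = 0 := by
  set N : ℝ := v (-1) 0 2 with hN
  -- the forward exit arcs `B R k` and their upper limits `Λ R`
  have harc := fun (R : ℕ) (k : ℕ) => exists_exitArc hγ hesc (τs k) (R := (R : ℝ) + 1) (by positivity)
  choose B hBconn hB0 hBball hBexit hBpar using harc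
  set Λ : ℕ → Set (EuclideanSpace ℝ (Fin 3)) := fun R => ⋂ n : ℕ, closure (⋃ k : ℕ, B R (n + k)) with hΛ
  -- (1) every `Λ R` is connected and contains `0`
  have hΛ0 : ∀ R, (0 : EuclideanSpace ℝ (Fin 3)) ∈ Λ R := fun R => mem_limsup_of_forall_mem (hB0 R)
  have hΛconn : ∀ R, IsPreconnected (Λ R) := fun R => isPreconnected_limsup (hBball R) (hBconn R) (hB0 R)
  -- (2) `Λ R` contains a point of norm `R + 1`
  have hΛfar : ∀ R : ℕ, ∃ s ∈ Λ R, ‖s‖ = (R : ℝ) + 1 := by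
    intro R
    choose s hsB hsn using hBexit R
    have hsph : ∀ k, s k ∈ sphere (0 : EuclideanSpace ℝ (Fin 3)) ((R : ℝ) + 1) := fun k => by
      rw [mem_sphere, dist_zero_right]; exact hsn k
    obtain ⟨a, ha, φ, hφ, hlim⟩ := (isCompact_sphere (0 : EuclideanSpace ℝ (Fin 3)) ((R : ℝ) + 1)).tendsto_subseq hsph
    refine ⟨a, mem_limsup_of_tendsto hsB hφ hlim, ?_⟩
    rw [mem_sphere, dist_zero_right] at ha
    exact ha
  -- (3) points of `Λ R` are planar
  have hΛplane : ∀ R, ∀ x ∈ Λ R, x 2 = 0 := by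
    intro R x hx
    have hC : IsClosed {y : EuclideanSpace ℝ (Fin 3) | y 2 = 0} := isClosed_eq (EuclideanSpace.proj (𝕜 := ℝ) (2 : Fin 3)).continuous continuous_const
    refine limsup_subset_of_subset hC (fun k y hy => ?_) hx
    obtain ⟨σ, -, rfl⟩ := hBpar R k y hy
    show (γ σ - γ (τs k)) 2 = 0
    rw [PiLp.sub_apply, (hhot σ).1, (hhot (τs k)).1, sub_zero]
  -- (4) points of `Λ R` are hot for `U`: `U₂(−1,x) = N`
  have hΛhot : ∀ R, ∀ x ∈ Λ R, U (-1) x 2 = N := by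
    intro R x hx
    by_contra hne
    set ε : ℝ := |U (-1) x 2 - N| / 3 with hε
    have hε0 : 0 < ε := by have := abs_pos.2 (sub_ne_zero.2 hne); positivity
    obtain ⟨t, ht, hev⟩ := (Metric.tendstoLocallyUniformly_iff.1 hlu₁) ε hε0 x
    have ht' : ∀ᶠ y in 𝓝 x, dist (U (-1) y) (U (-1) x) < ε := Metric.tendsto_nhds.1 hUc.continuousAt ε hε0
    obtain ⟨k₀, hk₀⟩ := Filter.eventually_atTop.1 hev
    obtain ⟨k, hk, y, hyt, hyB⟩ := exists_mem_of_mem_limsup hx (Filter.inter_mem ht ht') k₀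
    obtain ⟨σ, -, hyσ⟩ := hBpar R k y hyB
    have h1 : dist (U (-1) y) (v (-1) (y + γ (τs k))) < ε := hk₀ k hk y hyt.1
    have h2 : dist (U (-1) y) (U (-1) x) < ε := hyt.2
    have h3 : v (-1) (y + γ (τs k)) 2 = N := by rw [hyσ, sub_add_cancel]; exact (hhot σ).2
    have h4 := abs_sub_apply_le (U (-1) y) (v (-1) (y + γ (τs k))) 2
    have h5 := abs_sub_apply_le (U (-1) y) (U (-1) x) 2
    rw [h3] at h4
    have h6 : |U (-1) x 2 - N| ≤ |U (-1) y 2 - N| + |U (-1) y 2 - U (-1) x 2| := by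
      have := abs_sub_le (U (-1) x 2) (U (-1) y 2) N
      rw [abs_sub_comm (U (-1) x 2) (U (-1) y 2)] at this
      linarith
    have h7 : |U (-1) x 2 - N| = 3 * ε := by rw [hε]; ring
    linarith
  -- (5) points of `Λ R` are null for `ω_U`
  have hΛnull : ∀ R, ∀ x ∈ Λ R, curl (U (-1)) x = 0 := by
    intro R x hx
    by_contra hne
    set ε : ℝ := ‖curl (U (-1)) x‖ / 3 with hε
    have hε0 : 0 < ε := by have := norm_pos_iff.2 hne; positivity
    obtain ⟨t, ht, hev⟩ := (Metric.tendstoLocallyUniformly_iff.1 hlu₂) ε hε0 x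
    have ht' : ∀ᶠ y in 𝓝 x, dist (curl (U (-1)) y) (curl (U (-1)) x) < ε := Metric.tendsto_nhds.1 hωc.continuousAt ε hε0
    -- vorticity is small along the far part of `γ`
    have hωs : ∀ᶠ τ in atTop, ‖curl (v (-1)) (γ τ)‖ < ε :=
      (Metric.tendsto_nhds.1 hω ε hε0).mono fun τ h => by rwa [dist_zero_right] at h
    obtain ⟨T, hT⟩ := Filter.eventually_atTop.1 hωs
    obtain ⟨k₁, hk₁⟩ := Filter.eventually_atTop.1 (hτs.eventually (Filter.eventually_ge_atTop T))
    obtain ⟨k₀, hk₀⟩ := Filter.eventually_atTop.1 hev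
    obtain ⟨k, hk, y, hyt, hyB⟩ := exists_mem_of_mem_limsup hx (Filter.inter_mem ht ht') (max k₀ k₁)
    obtain ⟨σ, hσ, hyσ⟩ := hBpar R k y hyB
    have h1 : dist (curl (U (-1)) y) (curl (v (-1)) (y + γ (τs k))) < ε := hk₀ k ((le_max_left _ _).trans hk) y hyt.1
    have h2 : dist (curl (U (-1)) y) (curl (U (-1)) x) < ε := hyt.2
    have h3 : ‖curl (v (-1)) (y + γ (τs k))‖ < ε := by
      rw [hyσ, sub_add_cancel]
      exact hT σ ((hk₁ k ((le_max_right _ _).trans hk)).trans hσ)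
    have h4 : ‖curl (U (-1)) x‖ ≤ dist (curl (U (-1)) y) (curl (U (-1)) x) + dist (curl (U (-1)) y) (curl (v (-1)) (y + γ (τs k))) +
        ‖curl (v (-1)) (y + γ (τs k))‖ := by
      rw [dist_eq_norm, dist_eq_norm]
      calc ‖curl (U (-1)) x‖ = ‖(curl (U (-1)) x - curl (U (-1)) y) + (curl (U (-1)) y - curl (v (-1)) (y + γ (τs k))) + curl (v (-1)) (y + γ (τs k))‖ := by
            congr 1; abel
        _ ≤ ‖curl (U (-1)) x - curl (U (-1)) y‖ + ‖curl (U (-1)) y - curl (v (-1)) (y + γ (τs k))‖ + ‖curl (v (-1)) (y + γ (τs k))‖ :=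
            (norm_add_le _ _).trans (add_le_add (norm_add_le _ _) le_rfl)
        _ = _ := by rw [norm_sub_rev (curl (U (-1)) x)]
    have h7 : ‖curl (U (-1)) x‖ = 3 * ε := by rw [hε]; ring
    linarith
  -- (6) the union over all radii
  refine ⟨⋃ R : ℕ, Λ R, ?_, mem_iUnion.2 ⟨0, hΛ0 0⟩, ?_, ?_, ?_⟩
  · intro x hx
    obtain ⟨R, hR⟩ := mem_iUnion.1 hx
    exact ⟨hΛplane R x hR, by rw [hΛhot R x hR, hΛhot R 0 (hΛ0 R)]⟩
  · exact ⟨⟨0, mem_iUnion.2 ⟨0, hΛ0 0⟩⟩, isPreconnected_iUnion ⟨0, mem_iInter.2 hΛ0⟩ hΛconn⟩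
  · intro hbdd
    obtain ⟨C, hC⟩ := hbdd.subset_closedBall 0
    obtain ⟨m, hm⟩ := exists_nat_gt C
    obtain ⟨s, hs, hsn⟩ := hΛfar m
    have h := hC (mem_iUnion.2 ⟨m, hs⟩)
    rw [mem_closedBall, dist_zero_right, hsn] at h
    linarith
  · intro x hx
    obtain ⟨R, hR⟩ := mem_iUnion.1 hx
    exact hΛnull R x hR

/-! ### H4, both ends -/

/-- **H4 `NullEndTopology` (LINE 21 «hot_hull», VERBATIM with `hotSet` unfolded).**  An injective hot curve escaping to infinity along the end `l ∈ {+∞, −∞}`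
with `ω(−1,γ τ) → 0`, whose translates by `γ(τs k)` (`τs k → l`) converge locally uniformly (slice and vorticity slice at `s = −1`) to `U(−1,·)`,
`ω_U(−1,·)`, leaves a CONNECTED UNBOUNDED set `L ∋ 0` of hot points of `U` on which `ω_U(−1,·) = 0`. -/
theorem nullEndTopology :
    ∀ (v U : ℝ → EuclideanSpace ℝ (Fin 3) → EuclideanSpace ℝ (Fin 3)) (γ : ℝ → EuclideanSpace ℝ (Fin 3)) (τs : ℕ → ℝ) (l : Filter ℝ),
      (l = Filter.atTop ∨ l = Filter.atBot) →
      Continuous γ → Function.Injective γ → (∀ τ : ℝ, γ τ ∈ {y : EuclideanSpace ℝ (Fin 3) | y 2 = 0 ∧ v (-1) y 2 = v (-1) 0 2}) →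
      Filter.Tendsto γ l (Filter.cocompact _) →
      Filter.Tendsto (fun τ => Literature.Analysis.FluidPDE.curl (v (-1)) (γ τ)) l (nhds 0) →
      Filter.Tendsto τs Filter.atTop l →
      IsClosed {y : EuclideanSpace ℝ (Fin 3) | y 2 = 0 ∧ U (-1) y 2 = U (-1) 0 2} → Continuous (U (-1)) →
      Continuous (Literature.Analysis.FluidPDE.curl (U (-1))) →
      TendstoLocallyUniformly (fun k x => v (-1) (x + γ (τs k))) (U (-1)) Filter.atTop →
      TendstoLocallyUniformly (fun k x => Literature.Analysis.FluidPDE.curl (v (-1)) (x + γ (τs k)))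
        (Literature.Analysis.FluidPDE.curl (U (-1))) Filter.atTop →
      ∃ L : Set (EuclideanSpace ℝ (Fin 3)), L ⊆ {y : EuclideanSpace ℝ (Fin 3) | y 2 = 0 ∧ U (-1) y 2 = U (-1) 0 2} ∧
        (0 : EuclideanSpace ℝ (Fin 3)) ∈ L ∧ IsConnected L ∧
        ¬ Bornology.IsBounded L ∧ ∀ x ∈ L, Literature.Analysis.FluidPDE.curl (U (-1)) x = 0 := by
  intro v U γ τs l hl hγ _hinj hhot hesc hω hτs _hclosed hUc hωc hlu₁ hlu₂
  rcases hl with rfl | rfl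
  · exact nullEnd_atTop hγ hhot hesc hω hτs hUc hωc hlu₁ hlu₂
  · -- the end `−∞`: reflect the parameter
    have hγ' : Continuous fun τ : ℝ => γ (-τ) := hγ.comp continuous_neg
    have hhot' : ∀ τ : ℝ, (fun τ : ℝ => γ (-τ)) τ 2 = 0 ∧ v (-1) ((fun τ : ℝ => γ (-τ)) τ) 2 = v (-1) 0 2 := fun τ => hhot (-τ)
    have hesc' : Tendsto (fun τ : ℝ => γ (-τ)) atTop (cocompact _) := hesc.comp tendsto_neg_atTop_atBot
    have hω' : Tendsto (fun τ : ℝ => curl (v (-1)) ((fun τ : ℝ => γ (-τ)) τ)) atTop (𝓝 0) := hω.comp tendsto_neg_atTop_atBot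
    have hτs' : Tendsto (fun k => -τs k) atTop atTop := tendsto_neg_atBot_atTop.comp hτs
    have hlu₁' : TendstoLocallyUniformly (fun k x => v (-1) (x + (fun τ : ℝ => γ (-τ)) ((fun k => -τs k) k))) (U (-1)) atTop := by
      simpa only [neg_neg] using hlu₁
    have hlu₂' : TendstoLocallyUniformly (fun k x => curl (v (-1)) (x + (fun τ : ℝ => γ (-τ)) ((fun k => -τs k) k))) (curl (U (-1))) atTop := by
      simpa only [neg_neg] using hlu₂
    exact nullEnd_atTop hγ' hhot' hesc' hω' hτs' hUc hωc hlu₁' hlu₂'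

end Summit.NavierStokesRegularity.NavierStokesRegularity.Theorems.PoloidalWindowDoorPoloidalWindowRigidityHotHullNullEndTopology
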